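import Mathlib
import Summits.Ventures.HodgeRepro.Tier4.Common.CompactOpenLevel
import Summits.Ventures.HodgeRepro.Tier4.Line1.LinRegular
import Summits.Ventures.HodgeRepro.Tier4.Line1.AdelicParts
import Summits.Ventures.HodgeRepro.Tier4.Line4.LineScalars

/-!
# Tier4/Line4/OrbitBlocks — the blocks of `b⁻¹ γ₀ b′`, bounded coordinates, and linear regularity

Blind re-derivation cell `pub-hodge-repro`, Tier 4 «PROVE THE STEP» (README §9–§10), LINE L4, cut C-L4-PROPER
(t4-plan-4 g3 S14566, statement S14602), seat t4-L2-p3 (gen 4); module 3 of 4.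

* the finite-adelic scalars `escF` and `finM (esc x y) = escF x_f y_f`; the finite-adelic coordinate map;
* **`block_eq`**: for `mat b = Σ e_i P_i`, `mat b′ = Σ e′_j Q_j` and a rational `γ` commuting with `Ω`,
  `P_i · mat (b γ b′) · Q_j = (e_i e′_j) · adMat (P_i g₀ Q_j)`;
* **`exists_compact_coords`**: for a NON-ZERO rational block, the finite-part coordinates of the scalar `e_i e′_j` are
  read off the block continuously (the rational left inverse of `(x, y) ↦ x v + y Ωv` along a non-zero column `v`), so
  they range in a compact set when the element ranges in a compact set;
* **`exists_common_neighbour`**: `IsLinRegular γ₀` ⇒ some row `i` has both blocks `P_i g₀ Q_j ≠ 0` and some column `j`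
  has both blocks `P_i g₀ Q_j ≠ 0` — the four degenerate patterns produce a non-scalar kernel pair `(P_i, Q_j)`
  (`not_scalar_of_complementary`) or a vanishing `P_i g₀` / `g₀ Q_j`.

Mathlib + the line's landed modules only; no printed input; nothing here asserts anything about the truth of (P);
HC_CM is NOT proved by anyone in this repository.
-/

set_option autoImplicit false

noncomputable section

namespace Summit.Ventures.HodgeRepro.Tier4.Line4

open Summit.Ventures.HodgeRepro.Tier4 Summit.Ventures.HodgeRepro.Tier4.Common
  Summit.Ventures.HodgeRepro.Tier4.Line1 Matrix NumberField IsDedekindDomain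
open scoped Pointwise NumberField

variable {k : Type} [Field k] [NumberField k] (W : PlaneData k)

/-! ## 5. The finite parts of the scalars, and the BLOCKS of `b⁻¹ γ₀ b′` -/

section Blocks

/-- the finite-adelic `E′`-scalar -/
def escF (x y : FiniteAdeleRing (𝓞 k) k) : Matrix (Fin 4) (Fin 4) (FiniteAdeleRing (𝓞 k) k) :=
  x • (1 : Matrix (Fin 4) (Fin 4) (FiniteAdeleRing (𝓞 k) k)) + y • W.Ω.map (algebraMap k (FiniteAdeleRing (𝓞 k) k))

/-- the finite part of an adelic scalar is the finite-adelic scalar of the finite parts -/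
theorem finM_esc (x y : Ad k) : finM k (esc W x y) = escF W (finPart k x) (finPart k y) := by
  ext i j
  simp only [finM, esc, escF, adMat, Matrix.map_apply, Matrix.add_apply, Matrix.smul_apply, smul_eq_mul,
    Matrix.one_apply]
  split_ifs <;> simp only [map_add, map_mul, map_one, map_zero, finPart_algebraMap]

/-- a finite-adelic scalar acting on a rational vector: `x • v + y • Ωv` -/
theorem escF_mulVec (x y : FiniteAdeleRing (𝓞 k) k) (v : Fin 4 → k) :
    escF W x y *ᵥ (algebraMap k (FiniteAdeleRing (𝓞 k) k) ∘ v) =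
      x • (algebraMap k (FiniteAdeleRing (𝓞 k) k) ∘ v) +
        y • (algebraMap k (FiniteAdeleRing (𝓞 k) k) ∘ (W.Ω *ᵥ v)) := by
  have h : W.Ω.map (algebraMap k (FiniteAdeleRing (𝓞 k) k)) *ᵥ (algebraMap k (FiniteAdeleRing (𝓞 k) k) ∘ v) =
      algebraMap k (FiniteAdeleRing (𝓞 k) k) ∘ (W.Ω *ᵥ v) := by
    funext i
    exact (RingHom.map_mulVec (algebraMap k (FiniteAdeleRing (𝓞 k) k)) W.Ω v i).symm
  simp only [escF, add_mulVec, smul_mulVec, one_mulVec, h]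

/-- the finite-adelic coordinates along `v` -/
theorem coordF_escF_mulVec {R : Matrix (Fin 2) (Fin 4) k} {v : Fin 4 → k}
    (hR0 : R *ᵥ v = Pi.single 0 1) (hR1 : R *ᵥ (W.Ω *ᵥ v) = Pi.single 1 1) (x y : FiniteAdeleRing (𝓞 k) k) :
    R.map (algebraMap k (FiniteAdeleRing (𝓞 k) k)) *ᵥ
      (escF W x y *ᵥ (algebraMap k (FiniteAdeleRing (𝓞 k) k) ∘ v)) = ![x, y] := by
  have hmap : ∀ w : Fin 4 → k, R.map (algebraMap k (FiniteAdeleRing (𝓞 k) k)) *ᵥ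
      (algebraMap k (FiniteAdeleRing (𝓞 k) k) ∘ w) = algebraMap k (FiniteAdeleRing (𝓞 k) k) ∘ (R *ᵥ w) := by
    intro w
    funext i
    exact (RingHom.map_mulVec (algebraMap k (FiniteAdeleRing (𝓞 k) k)) R w i).symm
  rw [escF_mulVec, mulVec_add, mulVec_smul, mulVec_smul, hmap, hmap, hR0, hR1]
  funext i
  fin_cases i <;> simp

/-- `P_i` picks the `i`-th line scalar: `P_i (Σ_a e_a P_a) = e_i P_i` -/
theorem adMat_mul_decomp (P : Fin 2 → Matrix (Fin 4) (Fin 4) k) (hPΩ : ∀ i, P i * W.Ω = W.Ω * P i)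
    (hPi : ∀ i, P i * P i = P i) (hsum : P 0 + P 1 = 1) (x y : Fin 2 → Ad k) (i : Fin 2) :
    adMat k (P i) * (esc W (x 0) (y 0) * adMat k (P 0) + esc W (x 1) (y 1) * adMat k (P 1)) =
      esc W (x i) (y i) * adMat k (P i) := by
  have h : ∀ a : Fin 2, adMat k (P i) * (esc W (x a) (y a) * adMat k (P a)) =
      if i = a then esc W (x i) (y i) * adMat k (P i) else 0 := by
    intro a
    rw [← mul_assoc, ← esc_mul_adMat_comm W _ _ (hPΩ i), mul_assoc, ← adMat_mul]
    by_cases hia : i = a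
    · subst hia
      rw [if_pos rfl, hPi]
    · rw [if_neg hia, mul_eq_zero_of_ne P hPi hsum hia, adMat_zero, mul_zero]
  rw [mul_add, h 0, h 1]
  fin_cases i <;> simp

/-- `Q_j` picks the `j`-th line scalar on the right: `(Σ_b e′_b Q_b) Q_j = e′_j Q_j` -/
theorem decomp_mul_adMat (Q : Fin 2 → Matrix (Fin 4) (Fin 4) k)
    (hQi : ∀ j, Q j * Q j = Q j) (hsum : Q 0 + Q 1 = 1) (x y : Fin 2 → Ad k) (j : Fin 2) :
    (esc W (x 0) (y 0) * adMat k (Q 0) + esc W (x 1) (y 1) * adMat k (Q 1)) * adMat k (Q j) =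
      esc W (x j) (y j) * adMat k (Q j) := by
  have h : ∀ b : Fin 2, (esc W (x b) (y b) * adMat k (Q b)) * adMat k (Q j) =
      if b = j then esc W (x j) (y j) * adMat k (Q j) else 0 := by
    intro b
    rw [mul_assoc, ← adMat_mul]
    by_cases hbj : b = j
    · subst hbj
      rw [if_pos rfl, hQi]
    · rw [if_neg hbj, mul_eq_zero_of_ne Q hQi hsum hbj, adMat_zero, mul_zero]
  rw [add_mul, h 0, h 1]
  fin_cases j <;> simp

/-- **the blocks of `b γ b′`**: for `mat b = Σ e_i P_i`, `mat b′ = Σ e′_j Q_j`, `mat γ = adMat g₀` (rational, commuting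
with `Ω`), `P_i · mat (b γ b′) · Q_j = (e_i e′_j) · adMat (P_i g₀ Q_j)`. -/
theorem block_eq (x y x' y' : Fin 2 → Ad k) {b b' γ : GA W} {g₀ : Matrix (Fin 4) (Fin 4) k}
    (hb : GA.mat W b = esc W (x 0) (y 0) * adMat k (W.P 0) + esc W (x 1) (y 1) * adMat k (W.P 1))
    (hb' : GA.mat W b' = esc W (x' 0) (y' 0) * adMat k (W.Q 0) + esc W (x' 1) (y' 1) * adMat k (W.Q 1))
    (hγ : GA.mat W γ = adMat k g₀) (hg₀Ω : g₀ * W.Ω = W.Ω * g₀) (i j : Fin 2) :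
    adMat k (W.P i) * GA.mat W (b * γ * b') * adMat k (W.Q j) =
      esc W (x i) (y i) * esc W (x' j) (y' j) * adMat k (W.P i * g₀ * W.Q j) := by
  have hPb : adMat k (W.P i) * GA.mat W b = esc W (x i) (y i) * adMat k (W.P i) := by
    rw [hb]
    exact adMat_mul_decomp W W.P W.P_comm W.P_idem W.P_sum x y i
  have hb'Q : GA.mat W b' * adMat k (W.Q j) = esc W (x' j) (y' j) * adMat k (W.Q j) := by
    rw [hb']
    exact decomp_mul_adMat W W.Q W.Q_idem W.Q_sum x' y' j
  have hcomm1 : adMat k (W.P i) * esc W (x' j) (y' j) = esc W (x' j) (y' j) * adMat k (W.P i) :=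
    (esc_mul_adMat_comm W _ _ (W.P_comm i)).symm
  have hcomm2 : adMat k g₀ * esc W (x' j) (y' j) = esc W (x' j) (y' j) * adMat k g₀ :=
    (esc_mul_adMat_comm W _ _ hg₀Ω).symm
  calc adMat k (W.P i) * GA.mat W (b * γ * b') * adMat k (W.Q j)
      = (adMat k (W.P i) * GA.mat W b) * GA.mat W γ * (GA.mat W b' * adMat k (W.Q j)) := by
        simp only [GA.mat_mul, mul_assoc]
    _ = esc W (x i) (y i) * (adMat k (W.P i) * (adMat k g₀ * esc W (x' j) (y' j))) * adMat k (W.Q j) := by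
        rw [hPb, hb'Q, hγ]
        simp only [mul_assoc]
    _ = esc W (x i) (y i) * esc W (x' j) (y' j) * (adMat k (W.P i) * adMat k g₀ * adMat k (W.Q j)) := by
        rw [hcomm2, ← mul_assoc (adMat k (W.P i)), hcomm1]
        simp only [mul_assoc]
    _ = _ := by rw [adMat_mul, adMat_mul]

end Blocks

/-! ## 6. Linear regularity: the block graph `{(i, j) : P_i g₀ Q_j ≠ 0}` has a common neighbour on each side -/

section Regular

/-- the rational matrix of a rational point -/
theorem exists_adMat_eq_mat (γ₀ : rationalPoints W) :
    ∃ g₀ : Matrix (Fin 4) (Fin 4) k, adMat k g₀ = GA.mat W (γ₀ : GA W) := by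
  have h : ((γ₀ : GA W) : GL4 k) ∈ principalGL (k := k) := Subgroup.mem_subgroupOf.1 γ₀.2
  obtain ⟨A, hA⟩ := MonoidHom.mem_range.1 h
  refine ⟨(A : Matrix (Fin 4) (Fin 4) k), ?_⟩
  change adMat k (A : Matrix (Fin 4) (Fin 4) k) = (((γ₀ : GA W) : GL4 k) : M4 k)
  rw [← hA]
  rfl

/-- the rational matrix of an adelic unitary is invertible -/
theorem det_ne_zero_of_adMat_eq_mat (γ : GA W) {g₀ : Matrix (Fin 4) (Fin 4) k} (h : adMat k g₀ = GA.mat W γ) :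
    g₀.det ≠ 0 := by
  intro h0
  have hu : IsUnit (GA.mat W γ).det := (Matrix.isUnit_iff_isUnit_det _).1 (γ : GL4 k).isUnit
  rw [← h] at hu
  have : (adMat k g₀).det = algebraMap k (Ad k) g₀.det := by
    rw [RingHom.map_det, RingHom.mapMatrix_apply]
    rfl
  rw [this, h0, map_zero] at hu
  haveI : Nontrivial (Ad k) := (NumberField.AdeleRing.algebraMap_injective (𝓞 k) k).nontrivial
  exact not_isUnit_zero hu

omit [NumberField k] in
/-- a matrix of rank `2` is not `0` -/
theorem ne_zero_of_rank_eq_two {A : Matrix (Fin 4) (Fin 4) k} (hr : A.rank = 2) : A ≠ 0 := by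
  intro h0
  rw [h0, Matrix.rank_zero] at hr
  exact absurd hr (by norm_num)

/-- a complementary rank-`2` projector is NOT an `E′_𝔸`-scalar (it kills the other line) -/
theorem not_scalar_of_complementary {d : k} (hΩ : W.Ω * W.Ω = -(d • (1 : Matrix (Fin 4) (Fin 4) k)))
    (hd : ¬ IsSquare (-d)) (P : Fin 2 → Matrix (Fin 4) (Fin 4) k) (hPi : ∀ i, P i * P i = P i)
    (hPr : ∀ i, (P i).rank = 2) (hsum : P 0 + P 1 = 1) (i : Fin 2) (x y : Ad k)
    (h : adMat k (P i) = x • (1 : M4 k) + y • adMat k W.Ω) : False := by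
  obtain ⟨z, hz, hzA⟩ := exists_ne_zero_mem_range (hPr (i + 1))
  have hPz : P i *ᵥ z = 0 := by
    obtain ⟨z', hz'⟩ := hzA
    simp only [mulVecLin_apply] at hz'
    rw [← hz', mulVec_mulVec, mul_eq_zero_of_ne P hPi hsum (by fin_cases i <;> decide), zero_mulVec]
  have h0 : esc W x y *ᵥ (algebraMap k (Ad k) ∘ z) = 0 := by
    rw [esc, ← h, adMat_mulVec_comp, hPz]
    funext a
    simp
  obtain ⟨hx, hy⟩ := eq_zero_of_esc_mulVec_eq_zero W hΩ hd hz h0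
  rw [hx, hy, zero_smul, zero_smul, add_zero, ← adMat_zero] at h
  exact ne_zero_of_rank_eq_two (hPr i) (adMat_injective h)

/-- **IsLinRegular ⇒ the block graph has a row vertex adjacent to both columns and a column vertex adjacent to both
rows** (the four degenerate patterns each produce a non-scalar kernel pair `(P_i, Q_j)` or a vanishing `P_i g₀`,
`g₀ Q_j`). -/
theorem exists_common_neighbour {d : k} (hΩ : W.Ω * W.Ω = -(d • (1 : Matrix (Fin 4) (Fin 4) k)))
    (hd : ¬ IsSquare (-d)) (hPr : ∀ i, (W.P i).rank = 2) (hQr : ∀ j, (W.Q j).rank = 2)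
    (γ₀ : rationalPoints W) (hreg : IsLinRegular W γ₀) {g₀ : Matrix (Fin 4) (Fin 4) k}
    (hg₀ : adMat k g₀ = GA.mat W (γ₀ : GA W)) :
    (∃ i, ∀ j, W.P i * g₀ * W.Q j ≠ 0) ∧ (∃ j, ∀ i, W.P i * g₀ * W.Q j ≠ 0) := by
  have hdet := det_ne_zero_of_adMat_eq_mat W (γ₀ : GA W) hg₀
  have hg₀Ω : g₀ * W.Ω = W.Ω * g₀ := by
    apply adMat_injective
    rw [adMat_mul, adMat_mul, hg₀]
    exact ((mem_unitaryGroup W _).1 (γ₀ : GA W).2).1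
  -- a row of zero blocks is impossible
  have hrow : ∀ i, ¬ (W.P i * g₀ * W.Q 0 = 0 ∧ W.P i * g₀ * W.Q 1 = 0) := by
    rintro i ⟨h0, h1⟩
    have h : W.P i * g₀ = 0 := by
      calc W.P i * g₀ = W.P i * g₀ * (W.Q 0 + W.Q 1) := by rw [W.Q_sum, mul_one]
        _ = 0 := by rw [mul_add, h0, h1, add_zero]
    have h' : W.P i = 0 := by
      calc W.P i = W.P i * g₀ * g₀⁻¹ := by
            rw [mul_assoc, Matrix.mul_nonsing_inv _ (isUnit_iff_ne_zero.2 hdet), mul_one]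
        _ = 0 := by rw [h, zero_mul]
    exact ne_zero_of_rank_eq_two (hPr i) h'
  -- a column of zero blocks is impossible
  have hcol : ∀ j, ¬ (W.P 0 * g₀ * W.Q j = 0 ∧ W.P 1 * g₀ * W.Q j = 0) := by
    rintro j ⟨h0, h1⟩
    have h : g₀ * W.Q j = 0 := by
      calc g₀ * W.Q j = (W.P 0 + W.P 1) * (g₀ * W.Q j) := by rw [W.P_sum, one_mul]
        _ = 0 := by rw [add_mul, ← mul_assoc, ← mul_assoc, h0, h1, add_zero]
    have h' : W.Q j = 0 := by
      calc W.Q j = g₀⁻¹ * (g₀ * W.Q j) := by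
            rw [← mul_assoc, Matrix.nonsing_inv_mul _ (isUnit_iff_ne_zero.2 hdet), one_mul]
        _ = 0 := by rw [h, mul_zero]
    exact ne_zero_of_rank_eq_two (hQr j) h'
  -- the commutation data of a `P`-projector and a `Q`-projector for `IsLinRegular`
  have hPcomm : ∀ i i', adMat k (W.P i) * adMat k (W.P i') = adMat k (W.P i') * adMat k (W.P i) := by
    intro i i'
    rw [← adMat_mul, ← adMat_mul]
    by_cases h : i = i'
    · rw [h]
    · rw [mul_eq_zero_of_ne W.P W.P_idem W.P_sum h, mul_eq_zero_of_ne W.P W.P_idem W.P_sum (Ne.symm h)]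
  have hQcomm : ∀ j j', adMat k (W.Q j) * adMat k (W.Q j') = adMat k (W.Q j') * adMat k (W.Q j) := by
    intro j j'
    rw [← adMat_mul, ← adMat_mul]
    by_cases h : j = j'
    · rw [h]
    · rw [mul_eq_zero_of_ne W.Q W.Q_idem W.Q_sum h, mul_eq_zero_of_ne W.Q W.Q_idem W.Q_sum (Ne.symm h)]
  have hPΩ : ∀ i, adMat k (W.P i) * adMat k W.Ω = adMat k W.Ω * adMat k (W.P i) := by
    intro i
    rw [← adMat_mul, ← adMat_mul, W.P_comm i]
  have hQΩ : ∀ j, adMat k (W.Q j) * adMat k W.Ω = adMat k W.Ω * adMat k (W.Q j) := by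
    intro j
    rw [← adMat_mul, ← adMat_mul, W.Q_comm j]
  -- a kernel pair `(P_i, Q_j)` contradicts regularity
  have hpair : ∀ i j, W.P i * g₀ = g₀ * W.Q j → False := by
    intro i j hij
    obtain ⟨x, y, hx, -⟩ := hreg (adMat k (W.P i)) (adMat k (W.Q j)) (hPΩ i) (fun i' => hPcomm i i') (hQΩ j)
      (fun j' => hQcomm j j') (by rw [← hg₀, ← adMat_mul, ← adMat_mul, hij])
    exact not_scalar_of_complementary W hΩ hd W.P W.P_idem hPr W.P_sum i x y hx
  -- the two diagonal patterns
  have hdiag0 : ¬ (W.P 0 * g₀ * W.Q 0 = 0 ∧ W.P 1 * g₀ * W.Q 1 = 0) := by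
    rintro ⟨h00, h11⟩
    refine hpair 1 0 ?_
    calc W.P 1 * g₀ = W.P 1 * g₀ * (W.Q 0 + W.Q 1) := by rw [W.Q_sum, mul_one]
      _ = W.P 1 * g₀ * W.Q 0 := by rw [mul_add, h11, add_zero]
      _ = (W.P 0 + W.P 1) * (g₀ * W.Q 0) := by rw [add_mul, ← mul_assoc, ← mul_assoc, h00, zero_add]
      _ = g₀ * W.Q 0 := by rw [W.P_sum, one_mul]
  have hdiag1 : ¬ (W.P 0 * g₀ * W.Q 1 = 0 ∧ W.P 1 * g₀ * W.Q 0 = 0) := by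
    rintro ⟨h01, h10⟩
    refine hpair 0 0 ?_
    calc W.P 0 * g₀ = W.P 0 * g₀ * (W.Q 0 + W.Q 1) := by rw [W.Q_sum, mul_one]
      _ = W.P 0 * g₀ * W.Q 0 := by rw [mul_add, h01, add_zero]
      _ = (W.P 0 + W.P 1) * (g₀ * W.Q 0) := by rw [add_mul, ← mul_assoc, ← mul_assoc, h10, add_zero]
      _ = g₀ * W.Q 0 := by rw [W.P_sum, one_mul]
  constructor
  · by_contra h
    have h' : ∀ i, ∃ j, W.P i * g₀ * W.Q j = 0 := fun i => by
      by_contra hi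
      exact h ⟨i, fun j hj => hi ⟨j, hj⟩⟩
    obtain ⟨j₀, hj₀⟩ := h' 0
    obtain ⟨j₁, hj₁⟩ := h' 1
    fin_cases j₀ <;> fin_cases j₁
    · exact hcol 0 ⟨hj₀, hj₁⟩
    · exact hdiag0 ⟨hj₀, hj₁⟩
    · exact hdiag1 ⟨hj₀, hj₁⟩
    · exact hcol 1 ⟨hj₀, hj₁⟩
  · by_contra h
    have h' : ∀ j, ∃ i, W.P i * g₀ * W.Q j = 0 := fun j => by
      by_contra hj
      exact h ⟨j, fun i hi => hj ⟨i, hi⟩⟩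
    obtain ⟨i₀, hi₀⟩ := h' 0
    obtain ⟨i₁, hi₁⟩ := h' 1
    fin_cases i₀ <;> fin_cases i₁
    · exact hrow 0 ⟨hi₀, hi₁⟩
    · exact hdiag0 ⟨hi₀, hi₁⟩
    · exact hdiag1 ⟨hi₁, hi₀⟩
    · exact hrow 1 ⟨hi₀, hi₁⟩

end Regular

/-! ## 8. Bounded blocks ⇒ bounded scalar coordinates (finite parts) -/

section Bounded

omit [NumberField k] in
/-- a non-zero matrix has a non-zero column -/
theorem exists_col_ne_zero {M : Matrix (Fin 4) (Fin 4) k} (hM : M ≠ 0) : ∃ j₀, M.col j₀ ≠ 0 := by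
  by_contra h
  refine hM (Matrix.ext fun i j => ?_)
  have hj : M.col j = 0 := by
    by_contra hj
    exact h ⟨j, hj⟩
  exact congrFun hj i

/-- **bounded blocks give bounded coordinates**: for a NON-ZERO rational matrix `M`, the finite-part coordinates
`(X_f, Y_f)` of a scalar `esc X Y` with `P_i N Q_j = finM (esc X Y · adMat M)`, `N` ranging over the finite parts of a
compact set of `G(𝔸)`, lie in a compact set (the rational left inverse `R` of `(x, y) ↦ x v + y Ωv`, `v` a non-zero
column of `M`, reads the coordinates off the block continuously). -/
theorem exists_compact_coords {d : k} (hΩ : W.Ω * W.Ω = -(d • (1 : Matrix (Fin 4) (Fin 4) k)))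
    (hd : ¬ IsSquare (-d)) {M : Matrix (Fin 4) (Fin 4) k} (hM : M ≠ 0)
    (Pm Qm : Matrix (Fin 4) (Fin 4) k) (C : Set (GA W)) (hC : IsCompact C) :
    ∃ K : Set (Fin 2 → FiniteAdeleRing (𝓞 k) k), IsCompact K ∧
      ∀ g ∈ C, ∀ X Y : Ad k,
        finM k (adMat k Pm) * finM k (GA.mat W g) * finM k (adMat k Qm) = finM k (esc W X Y * adMat k M) →
        ![finPart k X, finPart k Y] ∈ K := by
  obtain ⟨j₀, hj₀⟩ := exists_col_ne_zero hM
  obtain ⟨R, hR0, hR1⟩ := exists_coordMatrix W hΩ hd hj₀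
  set ιf := algebraMap k (FiniteAdeleRing (𝓞 k) k) with hιf
  let Ξ : GA W → Fin 2 → FiniteAdeleRing (𝓞 k) k := fun g =>
    R.map ιf *ᵥ ((finM k (adMat k Pm) * finM k (GA.mat W g) * finM k (adMat k Qm)) *ᵥ (ιf ∘ Pi.single j₀ 1))
  have hΞ : Continuous Ξ := by
    have hmat : Continuous fun g : GA W => GA.mat W g := Units.continuous_val.comp continuous_subtype_val
    have hfin : Continuous fun g : GA W => finM k (GA.mat W g) := hmat.matrix_map continuous_finPart
    exact continuous_const.matrix_mulVec
      (((continuous_const.matrix_mul hfin).matrix_mul continuous_const).matrix_mulVec continuous_const)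
  refine ⟨Ξ '' C, hC.image hΞ, ?_⟩
  intro g hg X Y h
  refine ⟨g, hg, ?_⟩
  show R.map ιf *ᵥ ((finM k (adMat k Pm) * finM k (GA.mat W g) * finM k (adMat k Qm)) *ᵥ (ιf ∘ Pi.single j₀ 1)) = _
  rw [h, finM_mul, finM_esc, finM_adMat, ← mulVec_mulVec]
  have hcol : M.map ιf *ᵥ (ιf ∘ Pi.single j₀ 1) = ιf ∘ M.col j₀ := by
    rw [← mulVec_single_one M j₀]
    funext i
    exact (RingHom.map_mulVec ιf M _ i).symm
  rw [hcol]
  exact coordF_escF_mulVec W hR0 hR1 _ _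

end Bounded

end Summit.Ventures.HodgeRepro.Tier4.Line4

end
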